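import Summits.QuantumFields.YangMills.Theorems.FemtoTransferGapSpectralSums
import Summits.QuantumFields.YangMills.Theorems.FemtoTransferGapSpectralSumsRoot
import HarnessLib

/-!
# Femto transfer gap — ★ THE BLOCK-TO-FINE DOOR `K = (K^ℓ)^{1/ℓ}` for once-block-dressed physical vectors
# (crux idea «block-endpoint» on crux `DressedRitz`, stmt-QuantumFields-20205; first lemma `BlockToFine` of `Cruxes/DressedRitz/BlockEndpointSketch.lean`,
# ym-cruxidea-20205-2 GEN 3, PROVED here in the tree's currency; LEAD prover ym-lead-20205-polyakovlift g4)

Let `K = K_β` be the zero-flux transfer operator (`β > 0`), `v` a physical test function, `ℓ ≥ 1` a temporal BLOCK length, `P = K^ℓ`, and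
`u = P v = K^ℓ v` the once-block-dressed vector.  The BLOCK DEFECT of a vector `ψ` is `⟨ψ,P²ψ⟩⟨ψ,ψ⟩/⟨ψ,Pψ⟩² − 1` (relative variance of `λ^ℓ` under
the spectral measure of `ψ`).  If the block defects of BOTH `v` (raw) and `u` (dressed) are `≤ δ ≤ 1/32`, then

* ★ (a) `jensen_root`: `⟨u,Ku⟩^ℓ ≤ ⟨u,Pu⟩·⟨u,u⟩^{ℓ−1}` (for every physical `u = K^ℓ v`, no defect hypothesis);
* ★ (b) `reverse_jensen_root`: `⟨u,Pu⟩·⟨u,u⟩^{ℓ−1} ≤ e^{15δ}·⟨u,Ku⟩^ℓ`;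
* ★★ (c) `defect_contraction`: `‖Ku‖²·‖u‖² − ⟨u,Ku⟩² ≤ (600δ/ℓ²)·⟨u,Ku⟩²` — THE FINE ONE-STEP DEFECT IS THE BLOCK DEFECT DIVIDED BY `ℓ²`;
* `leakage_of_blockDefects`: (c) in the (o4) currency of `OpPlat.PlateauClauses` ∕ `PolyakovLift.LeakageClause`:
  `‖Ku‖²‖u‖² − ⟨u,Ku⟩² ≤ (600δ/ℓ²)·λ₀²·‖u‖⁴`.

So every `1/L`- and `1/L²`-precision FINE clause of a dressed family with `ℓ = L` dressing steps (line «polyakovlift»: `dressSteps L = L`) follows from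
BLOCK-ALIGNED two-point data (times `0, L, 2L, 3L, 4L`) at `L`-FREE relative precision `δ` — the renormalisation-group supplier is never asked for an
`L`-dependent tolerance (companion `…PolyakovLiftBlockLeakage.lean`: `LeakageForL P ⟸ BlockLeakageForL P`).  Mechanism: exact spectral sums
(`SpecSum.exists_spectral_eigenseq`) + the pure-real root inequalities `SpecSum.jensen_root ∕ reverse_jensen_root ∕ defect_contraction`
(`FemtoTransferGapSpectralSumsRoot`).

HONEST FRAMING: fixed-lattice transfer-operator algebra (any `L`, `β > 0`), infrastructure for the CONDITIONAL femto rung R2b1; it closes no stub by itself and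
bears on neither infinite volume, nor the continuum limit, nor the Clay gap.  References: Reed–Simon IV, Thm. XIII.1 [cite: ReedSimonIV1978, Thm. XIII.1];
M. Lüscher, U. Wolff, NPB 339 (1990) 222 [cite: LuscherWolff1990] (effective masses from block-time correlators).
-/

set_option autoImplicit false

noncomputable section

open MeasureTheory Filter Topology Real
open scoped BigOperators
open Literature.MathematicalPhysics.QuantumFieldTheory
open Literature.MathematicalPhysics.QuantumLattice

namespace Summit.QuantumFields.YangMills.Theorems.FemtoTransferGap

namespace BlockToFine

variable {L : ℕ} [NeZero L]

/-! ## §1 Spectral data of a physical vector, packaged for the root inequalities -/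

/-- The spectral sums `S_p = ⟨K^m v, K^n v⟩` (`m + n = p ∈ {ℓ, 2ℓ, 2ℓ+1, 2ℓ+2, 3ℓ, 4ℓ}`) of a physical `v` as `HasSum`s over one eigen-sequence, with
Bessel `Σ a_k² ≤ ⟨v,v⟩` and the Rayleigh bound `⟨u,Ku⟩ ≤ λ₀‖u‖²` for `u = K^ℓ v`. [cite: ReedSimonIV1978, Thm. XIII.1] -/
theorem exists_root_data {β : ℝ} (hβ : 0 < β) {v : GaugeConfig 3 L SU2 → ℝ} (hv : IsPhys v) {ℓ : ℕ} (hℓ : 1 ≤ ℓ) :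
    ∃ (lam a : ℕ → ℝ) (A : ℝ), (∀ k, 0 ≤ lam k) ∧ HasSum (fun k => a k ^ 2) A ∧ A ≤ l2 v v ∧
      HasSum (fun k => lam k ^ ℓ * a k ^ 2) (l2 v ((transferApply β)^[ℓ] v)) ∧
      HasSum (fun k => lam k ^ (2 * ℓ) * a k ^ 2) (l2 ((transferApply β)^[ℓ] v) ((transferApply β)^[ℓ] v)) ∧
      HasSum (fun k => lam k ^ (2 * ℓ + 1) * a k ^ 2) (l2 ((transferApply β)^[ℓ] v) ((transferApply β)^[ℓ + 1] v)) ∧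
      HasSum (fun k => lam k ^ (2 * ℓ + 2) * a k ^ 2) (l2 ((transferApply β)^[ℓ + 1] v) ((transferApply β)^[ℓ + 1] v)) ∧
      HasSum (fun k => lam k ^ (3 * ℓ) * a k ^ 2) (l2 ((transferApply β)^[ℓ] v) ((transferApply β)^[2 * ℓ] v)) ∧
      HasSum (fun k => lam k ^ (4 * ℓ) * a k ^ 2) (l2 ((transferApply β)^[ℓ] v) ((transferApply β)^[3 * ℓ] v)) ∧
      l2 ((transferApply β)^[ℓ] v) ((transferApply β)^[ℓ + 1] v) ≤
        levelValue su2Rep L β 0 * l2 ((transferApply β)^[ℓ] v) ((transferApply β)^[ℓ] v) := by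
  obtain ⟨e, -, -, hdom, hsum, hbessel⟩ := SpecSum.exists_spectral_eigenseq (L := L) hβ
  set lam : ℕ → ℝ := fun k => levelValue su2Rep L β k with hlam
  set a : ℕ → ℝ := fun k => l2 v ((e k : physSubmodule L) : GaugeConfig 3 L SU2 → ℝ) with ha
  obtain ⟨hsA, hAle⟩ := hbessel v hv
  have hS : ∀ m n : ℕ, 1 ≤ m + n → ∀ p : ℕ, p = m + n →
      HasSum (fun k => lam k ^ p * a k ^ 2) (l2 ((transferApply β)^[m] v) ((transferApply β)^[n] v)) := by
    intro m n hmn p hp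
    refine (hsum v v hv hv m n hmn).congr_fun fun k => ?_
    rw [hp, sq]; ring
  have h0 : (transferApply β)^[0] v = v := rfl
  refine ⟨lam, a, _, fun k => levelValue_su2Rep_nonneg L hβ.le k, hsA.hasSum, hAle, ?_, ?_, ?_, ?_, ?_, ?_, ?_⟩
  · have := hS 0 ℓ (by omega) ℓ (by omega); rwa [h0] at this
  · exact hS ℓ ℓ (by omega) (2 * ℓ) (by omega)
  · exact hS ℓ (ℓ + 1) (by omega) (2 * ℓ + 1) (by omega)
  · exact hS (ℓ + 1) (ℓ + 1) (by omega) (2 * ℓ + 2) (by omega)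
  · exact hS ℓ (2 * ℓ) (by omega) (3 * ℓ) (by omega)
  · exact hS ℓ (3 * ℓ) (by omega) (4 * ℓ) (by omega)
  · have hu : IsPhys ((transferApply β)^[ℓ] v) := isPhys_iterate_transferApply β hv ℓ
    have h := hdom 0 _ hu (fun i hi => absurd hi (Nat.not_lt_zero i))
    rwa [qform_eq_l2_transferApply, ← Function.iterate_succ_apply' (transferApply β) ℓ v] at h

/-! ## §2 ★ The door -/

/-- ★ **(a) JENSEN ROOT** for `u = K^ℓ v`, `v` physical, `β > 0`, `ℓ ≥ 1`: `⟨u,Ku⟩^ℓ ≤ ⟨u,K^ℓu⟩·⟨u,u⟩^{ℓ−1}` (the fine Rayleigh quotient to the `ℓ`-th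
power is at most the block Rayleigh quotient; power mean on the spectral measure). [cite: ReedSimonIV1978, Thm. XIII.1] -/
theorem jensen_root {β : ℝ} (hβ : 0 < β) {v : GaugeConfig 3 L SU2 → ℝ} (hv : IsPhys v) {ℓ : ℕ} (hℓ : 1 ≤ ℓ) :
    l2 ((transferApply β)^[ℓ] v) (transferApply β ((transferApply β)^[ℓ] v)) ^ ℓ ≤
      l2 ((transferApply β)^[ℓ] v) ((transferApply β)^[ℓ] ((transferApply β)^[ℓ] v)) *
        l2 ((transferApply β)^[ℓ] v) ((transferApply β)^[ℓ] v) ^ (ℓ - 1) := by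
  obtain ⟨lam, a, A, hnn, -, -, -, hS2l, hS2l1, -, hS3l, -, -⟩ := exists_root_data hβ hv hℓ
  rw [← Function.iterate_succ_apply' (transferApply β) ℓ v, ← Function.iterate_add_apply, show ℓ + ℓ = 2 * ℓ by ring]
  have h2l : 0 ≤ l2 ((transferApply β)^[ℓ] v) ((transferApply β)^[ℓ] v) := l2_self_nonneg _
  rcases h2l.eq_or_lt with h0 | hpos
  · -- degenerate: ‖u‖ = 0 ⇒ ⟨u,Ku⟩ = 0 by the Rayleigh bound and positivity
    have hu : IsPhys ((transferApply β)^[ℓ] v) := isPhys_iterate_transferApply β hv ℓ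
    have hq0 : 0 ≤ l2 ((transferApply β)^[ℓ] v) ((transferApply β)^[ℓ + 1] v) := by
      rw [Function.iterate_succ_apply', ← qform_eq_l2_transferApply]; exact qform_su2Rep_self_nonneg hβ.le hu
    obtain ⟨-, -, -, -, -, -, -, -, -, -, -, -, hray⟩ := exists_root_data hβ hv hℓ
    rw [← h0, mul_zero] at hray
    have hq : l2 ((transferApply β)^[ℓ] v) ((transferApply β)^[ℓ + 1] v) = 0 := le_antisymm hray hq0
    have hℓne : ℓ ≠ 0 := by omega
    rw [hq, zero_pow hℓne]
    exact mul_nonneg (hS3l.nonneg fun k => mul_nonneg (pow_nonneg (hnn k) _) (sq_nonneg _)) (pow_nonneg h2l _)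
  · exact SpecSum.jensen_root hnn hℓ hS2l hS2l1 hS3l hpos

/-- ★ **(b) REVERSE JENSEN ROOT**: if the block defects of `v` (raw) and of `u = K^ℓ v` (dressed) are `≤ δ ≤ 1/32` then
`⟨u,K^ℓu⟩·⟨u,u⟩^{ℓ−1} ≤ e^{15δ}·⟨u,Ku⟩^ℓ`. [cite: ReedSimonIV1978, Thm. XIII.1] -/
theorem reverse_jensen_root {β : ℝ} (hβ : 0 < β) {v : GaugeConfig 3 L SU2 → ℝ} (hv : IsPhys v) {ℓ : ℕ} (hℓ : 1 ≤ ℓ) {δ : ℝ}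
    (hδ0 : 0 ≤ δ) (hδ : δ ≤ 1 / 32) (hpos : 0 < l2 ((transferApply β)^[ℓ] v) ((transferApply β)^[ℓ] v))
    (hraw : l2 v ((transferApply β)^[2 * ℓ] v) * l2 v v ≤ (1 + δ) * l2 v ((transferApply β)^[ℓ] v) ^ 2)
    (hdress : l2 ((transferApply β)^[ℓ] v) ((transferApply β)^[2 * ℓ] ((transferApply β)^[ℓ] v)) *
        l2 ((transferApply β)^[ℓ] v) ((transferApply β)^[ℓ] v) ≤
      (1 + δ) * l2 ((transferApply β)^[ℓ] v) ((transferApply β)^[ℓ] ((transferApply β)^[ℓ] v)) ^ 2) :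
    l2 ((transferApply β)^[ℓ] v) ((transferApply β)^[ℓ] ((transferApply β)^[ℓ] v)) *
        l2 ((transferApply β)^[ℓ] v) ((transferApply β)^[ℓ] v) ^ (ℓ - 1) ≤
      Real.exp (15 * δ) * l2 ((transferApply β)^[ℓ] v) (transferApply β ((transferApply β)^[ℓ] v)) ^ ℓ := by
  obtain ⟨lam, a, A, hnn, hA, hAle, hSl, hS2l, hS2l1, -, hS3l, hS4l, -⟩ := exists_root_data hβ hv hℓ
  rw [← Function.iterate_add_apply, show 2 * ℓ + ℓ = 3 * ℓ by ring] at hdress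
  rw [← Function.iterate_add_apply, show ℓ + ℓ = 2 * ℓ by ring] at hdress ⊢
  rw [← Function.iterate_succ_apply' (transferApply β) ℓ v]
  have hraw' : l2 ((transferApply β)^[ℓ] v) ((transferApply β)^[ℓ] v) * l2 v v ≤ (1 + δ) * l2 v ((transferApply β)^[ℓ] v) ^ 2 := by
    rw [l2_iterate_iterate β hv, show ℓ + ℓ = 2 * ℓ by ring]; exact hraw
  exact SpecSum.reverse_jensen_root hnn hℓ hA hSl hS2l hS2l1 hS3l hS4l hpos hAle hδ0 hδ hraw' hdress

/-- ★★ **(c) DEFECT CONTRACTION**: if the block defects of `v` (raw) and of `u = K^ℓ v` (dressed) are `≤ δ ≤ 1/32` then the FINE one-step defect of `u`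
is the block defect divided by `ℓ²`: `‖Ku‖²·‖u‖² − ⟨u,Ku⟩² ≤ (600δ/ℓ²)·⟨u,Ku⟩²`. [cite: ReedSimonIV1978, Thm. XIII.1] -/
theorem defect_contraction {β : ℝ} (hβ : 0 < β) {v : GaugeConfig 3 L SU2 → ℝ} (hv : IsPhys v) {ℓ : ℕ} (hℓ : 1 ≤ ℓ) {δ : ℝ}
    (hδ0 : 0 ≤ δ) (hδ : δ ≤ 1 / 32)
    (hraw : l2 v ((transferApply β)^[2 * ℓ] v) * l2 v v ≤ (1 + δ) * l2 v ((transferApply β)^[ℓ] v) ^ 2)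
    (hdress : l2 ((transferApply β)^[ℓ] v) ((transferApply β)^[2 * ℓ] ((transferApply β)^[ℓ] v)) *
        l2 ((transferApply β)^[ℓ] v) ((transferApply β)^[ℓ] v) ≤
      (1 + δ) * l2 ((transferApply β)^[ℓ] v) ((transferApply β)^[ℓ] ((transferApply β)^[ℓ] v)) ^ 2) :
    l2 (transferApply β ((transferApply β)^[ℓ] v)) (transferApply β ((transferApply β)^[ℓ] v)) *
          l2 ((transferApply β)^[ℓ] v) ((transferApply β)^[ℓ] v) -
        l2 ((transferApply β)^[ℓ] v) (transferApply β ((transferApply β)^[ℓ] v)) ^ 2 ≤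
      600 * δ / (ℓ : ℝ) ^ 2 * l2 ((transferApply β)^[ℓ] v) (transferApply β ((transferApply β)^[ℓ] v)) ^ 2 := by
  obtain ⟨lam, a, A, hnn, hA, hAle, hSl, hS2l, hS2l1, hS2l2, hS3l, hS4l, -⟩ := exists_root_data hβ hv hℓ
  rw [← Function.iterate_add_apply, show 2 * ℓ + ℓ = 3 * ℓ by ring] at hdress
  rw [← Function.iterate_add_apply, show ℓ + ℓ = 2 * ℓ by ring] at hdress
  rw [← Function.iterate_succ_apply' (transferApply β) ℓ v]
  have h2l : 0 ≤ l2 ((transferApply β)^[ℓ] v) ((transferApply β)^[ℓ] v) := l2_self_nonneg _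
  rcases h2l.eq_or_lt with h0 | hpos
  · -- degenerate: ‖u‖ = 0
    rw [← h0, mul_zero, zero_sub]
    exact le_trans (neg_nonpos.2 (sq_nonneg _)) (by positivity)
  · have hraw' : l2 ((transferApply β)^[ℓ] v) ((transferApply β)^[ℓ] v) * l2 v v ≤ (1 + δ) * l2 v ((transferApply β)^[ℓ] v) ^ 2 := by
      rw [l2_iterate_iterate β hv, show ℓ + ℓ = 2 * ℓ by ring]; exact hraw
    exact SpecSum.defect_contraction hnn hℓ hA hSl hS2l hS2l1 hS2l2 hS3l hS4l hpos hAle hδ0 hδ hraw' hdress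

/-- ★ **(c) in LEAKAGE currency (o4)**: under the same hypotheses, `‖Ku‖²‖u‖² − ⟨u,Ku⟩² ≤ (600δ/ℓ²)·λ₀²·‖u‖⁴` (`⟨u,Ku⟩ ≤ λ₀‖u‖²`). This is the
clause `PolyakovLift.LeakageClause` / (o4) of `OpPlat.PlateauClauses` for `u` with constant `600δ·L²/(ℓ²λ³)` in place of `C·λ³/L²` — at `ℓ = L`, `δ = Cλ³`:
constant `600·C`. [cite: LuscherWolff1990] [cite: ReedSimonIV1978, Thm. XIII.1] -/
theorem leakage_of_blockDefects {β : ℝ} (hβ : 0 < β) {v : GaugeConfig 3 L SU2 → ℝ} (hv : IsPhys v) {ℓ : ℕ} (hℓ : 1 ≤ ℓ) {δ : ℝ}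
    (hδ0 : 0 ≤ δ) (hδ : δ ≤ 1 / 32)
    (hraw : l2 v ((transferApply β)^[2 * ℓ] v) * l2 v v ≤ (1 + δ) * l2 v ((transferApply β)^[ℓ] v) ^ 2)
    (hdress : l2 ((transferApply β)^[ℓ] v) ((transferApply β)^[2 * ℓ] ((transferApply β)^[ℓ] v)) *
        l2 ((transferApply β)^[ℓ] v) ((transferApply β)^[ℓ] v) ≤
      (1 + δ) * l2 ((transferApply β)^[ℓ] v) ((transferApply β)^[ℓ] ((transferApply β)^[ℓ] v)) ^ 2) :
    l2 (transferApply β ((transferApply β)^[ℓ] v)) (transferApply β ((transferApply β)^[ℓ] v)) *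
          l2 ((transferApply β)^[ℓ] v) ((transferApply β)^[ℓ] v) -
        l2 ((transferApply β)^[ℓ] v) (transferApply β ((transferApply β)^[ℓ] v)) ^ 2 ≤
      600 * δ / (ℓ : ℝ) ^ 2 * levelValue su2Rep L β 0 ^ 2 * l2 ((transferApply β)^[ℓ] v) ((transferApply β)^[ℓ] v) ^ 2 := by
  have hc := defect_contraction hβ hv hℓ hδ0 hδ hraw hdress
  obtain ⟨-, -, -, -, -, -, -, -, -, -, -, -, hray⟩ := exists_root_data hβ hv hℓ
  rw [← Function.iterate_succ_apply' (transferApply β) ℓ v] at hc ⊢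
  have hq0 : 0 ≤ l2 ((transferApply β)^[ℓ] v) ((transferApply β)^[ℓ + 1] v) := by
    rw [Function.iterate_succ_apply', ← qform_eq_l2_transferApply]
    exact qform_su2Rep_self_nonneg hβ.le (isPhys_iterate_transferApply β hv ℓ)
  have hsq : l2 ((transferApply β)^[ℓ] v) ((transferApply β)^[ℓ + 1] v) ^ 2 ≤
      levelValue su2Rep L β 0 ^ 2 * l2 ((transferApply β)^[ℓ] v) ((transferApply β)^[ℓ] v) ^ 2 := by
    rw [← mul_pow]; exact pow_le_pow_left₀ hq0 hray 2
  have hcoef : 0 ≤ 600 * δ / (ℓ : ℝ) ^ 2 := by positivity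
  calc _ ≤ 600 * δ / (ℓ : ℝ) ^ 2 * l2 ((transferApply β)^[ℓ] v) ((transferApply β)^[ℓ + 1] v) ^ 2 := hc
    _ ≤ 600 * δ / (ℓ : ℝ) ^ 2 * (levelValue su2Rep L β 0 ^ 2 * l2 ((transferApply β)^[ℓ] v) ((transferApply β)^[ℓ] v) ^ 2) :=
        mul_le_mul_of_nonneg_left hsq hcoef
    _ = _ := by ring

end BlockToFine

end Summit.QuantumFields.YangMills.Theorems.FemtoTransferGap

end
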